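import Mathlib.Topology.Instances.Matrix
import Literature.MathematicalPhysics.QuantumLattice.LiebFluxPhaseDLS
import HarnessLib

/-!
# Decorated Dyson–Lieb–Simon positivity

Stub `stub_twistTraceNonneg` of the line `Sketch` of crux `LatticeODLROOffHalfFilling`
(route BECGroundStateSOS): the pure matrix-analysis heart of the reflection-positivity proof that
the twisted partition function `Z(θ) = Tr(e^{−βH} e^{iθS³_tot})` of the S=½ XY model on an even
torus is real and nonnegative. For ARBITRARY complex square matrices `A, W, Mᵢ` (size `m`),

`Tr[(W ⊗ W̄) · exp(A ⊗ 1 + 1 ⊗ Ā + Σᵢ Mᵢ ⊗ M̄ᵢ)]` is real and `≥ 0`,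

where `X̄ = Xᴴᵀ` is the entrywise complex conjugate ([DLS1978] Lemma 4.1 / Theorem 4.2;
[LSSY2005] Ch. 11 (11.5)–(11.7)).

## Proof

The Euler approximants `F_N = Σₐ Xₐ ⊗ X̄ₐ`, `Xₐ ∈ {1 + A/N} ∪ {N^{-1/2} Mᵢ}`, satisfy
`F_N^N → exp(A⊗1 + 1⊗Ā + ΣMᵢ⊗M̄ᵢ)` (`Matrix.tendsto_approximant_pow`). Expanding
`F_N^N = Σ_c X_c ⊗ X̄_c` over ordered words `c` (`sum_pow_eq_sum_ofFn_prod`,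
`Matrix.ofFn_prod_kronecker`, and `ᴴᵀ` is multiplicative), `(W ⊗ W̄)(X_c ⊗ X̄_c) = (W X_c) ⊗ (W X_c)‾`
has trace `Tr(W X_c) · (Tr(W X_c))^* = |Tr(W X_c)|²`, so `Tr[(W ⊗ W̄) F_N^N] = Σ_c |Tr(W X_c)|²` is
real and nonnegative for every `N` (`trace_twist_mul_pow_kroneckerSum_eq`); the set
`{z : 0 ≤ Re z, Im z = 0}` is closed and `Z ↦ Tr[(W ⊗ W̄) Z]` is continuous.

## References

* [DLS1978] F. J. Dyson, E. H. Lieb, B. Simon, *Phase transitions in quantum spin systems with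
  isotropic and nonisotropic interactions*, J. Stat. Phys. 18 (1978) 335–383, Lemma 4.1.
* [LSSY2005] E. H. Lieb, R. Seiringer, J. P. Solovej, J. Yngvason, *The Mathematics of the Bose
  Gas and its Condensation* (2005), Ch. 11, (11.5)–(11.7).
-/

noncomputable section

namespace Summit.AtomisticToContinuum.BoseEinsteinCondensation.Theorems.LatticeODLROOffHalfFilling.Ladder

open Literature.MathematicalPhysics.QuantumLattice Matrix Finset Filter Topology
open scoped ComplexOrder BigOperators Kronecker

/-! ### The entrywise conjugate `X ↦ Xᴴᵀ` on products -/

/-- The entrywise complex conjugate `X ↦ X̄ = Xᴴᵀ` is multiplicative (order preserving):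
`(X Y)‾ = X̄ Ȳ`. [folklore] -/
theorem conjTranspose_transpose_mul' {m : Type} [Fintype m] (X Y : Matrix m m ℂ) :
    (X * Y)ᴴᵀ = Xᴴᵀ * Yᴴᵀ := by
  rw [conjTranspose_mul, transpose_mul]

/-- The entrywise conjugate of an ordered product is the ordered product of the conjugates.
[folklore] -/
theorem conjTranspose_transpose_ofFn_prod {m : Type} [Fintype m] [DecidableEq m] {N : ℕ}
    (P : Fin N → Matrix m m ℂ) :
    ((List.ofFn P).prod)ᴴᵀ = (List.ofFn fun k => (P k)ᴴᵀ).prod := by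
  induction N with
  | zero => simp
  | succ N ih =>
    rw [List.ofFn_succ, List.ofFn_succ, List.prod_cons, List.prod_cons,
      conjTranspose_transpose_mul', ih]

/-! ### The decorated diagonal trace of a power is a sum of squares -/

/-- **Decorated sum of squares** ([LSSY2005] (11.6)–(11.7): "`Tr_H FθF̄ ΠAᵢθĀᵢ = |Tr_L FΠAᵢ|² ≥ 0`"):
for arbitrary complex square matrices `W`, `Xₐ` and every `N`,
`Tr[(W ⊗ W̄) (Σₐ Xₐ ⊗ X̄ₐ)^N] = Σ_{c : Fin N → C} |Tr(W X_{c₀}⋯X_{c_{N-1}})|²`.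
[cite: LSSY2005, Ch. 11 (11.6)–(11.7)] -/
theorem trace_twist_mul_pow_kroneckerSum_eq {m C : Type} [Fintype m] [DecidableEq m] [Fintype C]
    (W : Matrix m m ℂ) (X : C → Matrix m m ℂ) (N : ℕ) :
    ((W ⊗ₖ Wᴴᵀ) * (∑ a, X a ⊗ₖ (X a)ᴴᵀ) ^ N).trace =
      ((∑ c : Fin N → C, ‖(W * (List.ofFn fun k => X (c k)).prod).trace‖ ^ 2 : ℝ) : ℂ) := by
  rw [sum_pow_eq_sum_ofFn_prod, Finset.mul_sum, trace_sum, Complex.ofReal_sum]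
  refine sum_congr rfl fun c _ => ?_
  rw [ofFn_prod_kronecker, ← mul_kronecker_mul, trace_kronecker,
    ← conjTranspose_transpose_ofFn_prod, ← conjTranspose_transpose_mul', trace_transpose,
    trace_conjTranspose, Complex.star_def, Complex.mul_conj, Complex.normSq_eq_norm_sq]

/-- Hence `Tr[(W ⊗ W̄) (Σₐ Xₐ ⊗ X̄ₐ)^N]` is real and nonnegative. [folklore] -/
theorem trace_twist_mul_pow_kroneckerSum_nonneg {m C : Type} [Fintype m] [DecidableEq m]
    [Fintype C] (W : Matrix m m ℂ) (X : C → Matrix m m ℂ) (N : ℕ) :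
    0 ≤ ((W ⊗ₖ Wᴴᵀ) * (∑ a, X a ⊗ₖ (X a)ᴴᵀ) ^ N).trace.re ∧
      ((W ⊗ₖ Wᴴᵀ) * (∑ a, X a ⊗ₖ (X a)ᴴᵀ) ^ N).trace.im = 0 := by
  rw [trace_twist_mul_pow_kroneckerSum_eq, Complex.ofReal_re, Complex.ofReal_im]
  exact ⟨sum_nonneg fun c _ => sq_nonneg _, rfl⟩

/-! ### The conjugate of the Euler approximating family -/

/-- The entrywise conjugate maps the Euler approximating family of `(A, Mᵢ)` to that of
`(Ā, M̄ᵢ)`: `(1 + A/N)‾ = 1 + Ā/N`, `(N^{-1/2}Mᵢ)‾ = N^{-1/2}M̄ᵢ`. [folklore] -/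
theorem conjTranspose_transpose_approximant {m ι : Type} [DecidableEq m] (A : Matrix m m ℂ)
    (M : ι → Matrix m m ℂ) (N : ℕ) (a : Option ι) :
    (Option.elim a ((1 : Matrix m m ℂ) + ((N : ℂ))⁻¹ • A)
        (fun i => (((Real.sqrt N)⁻¹ : ℝ) : ℂ) • M i))ᴴᵀ =
      Option.elim a ((1 : Matrix m m ℂ) + ((N : ℂ))⁻¹ • Aᴴᵀ)
        (fun i => (((Real.sqrt N)⁻¹ : ℝ) : ℂ) • (M i)ᴴᵀ) := by
  rcases a with _ | i
  · simp only [Option.elim_none]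
    rw [conjTranspose_add, transpose_add, conjTranspose_one, transpose_one, conjTranspose_smul,
      transpose_smul, Complex.star_def, map_inv₀, Complex.conj_natCast]
  · simp only [Option.elim_some]
    rw [conjTranspose_smul, transpose_smul, Complex.star_def, Complex.conj_ofReal]

/-! ### The limit -/

/-- **Decorated Dyson–Lieb–Simon positivity.** For arbitrary complex square matrices `A, W, Mᵢ`:
`Tr[(W ⊗ W̄) · exp(A ⊗ 1 + 1 ⊗ Ā + Σᵢ Mᵢ ⊗ M̄ᵢ)]` is real and nonnegative (`X̄ = Xᴴᵀ` entrywise conjugate).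
Proof: the Euler approximants `(Σₐ Xₐ ⊗ X̄ₐ)^N`, `Xₐ ∈ {1 + A/N, N^{-1/2}Mᵢ}`, expand into words `Σ_c X_c ⊗ X̄_c`,
and `Tr[(W ⊗ W̄)(X_c ⊗ X̄_c)] = |Tr(W X_c)|² ≥ 0`; pass to the limit (`tendsto_approximant_pow`).
[DLS1978] Lemma 4.1 (with the "decoration" `W ⊗ W̄` of their Theorem 4.2); [LSSY2005] Ch. 11
(11.5)–(11.7). [cite: DLS1978, Lemma 4.1] -/
theorem stub_twistTraceNonneg {m ι : Type} [Fintype m] [DecidableEq m] [Fintype ι]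
    (A W : Matrix m m ℂ) (M : ι → Matrix m m ℂ) :
    0 ≤ (((W ⊗ₖ Wᴴᵀ) * NormedSpace.exp (A ⊗ₖ (1 : Matrix m m ℂ) + (1 : Matrix m m ℂ) ⊗ₖ Aᴴᵀ +
        ∑ i, M i ⊗ₖ (M i)ᴴᵀ)).trace).re ∧
      (((W ⊗ₖ Wᴴᵀ) * NormedSpace.exp (A ⊗ₖ (1 : Matrix m m ℂ) + (1 : Matrix m m ℂ) ⊗ₖ Aᴴᵀ +
        ∑ i, M i ⊗ₖ (M i)ᴴᵀ)).trace).im = 0 := by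
  cases isEmpty_or_nonempty m with
  | inl h =>
    -- empty index: every trace on `m × m` is an empty sum
    simp [Matrix.trace]
  | inr h =>
    -- the Euler approximating family
    set X : ℕ → Option ι → Matrix m m ℂ := fun N a =>
      Option.elim a ((1 : Matrix m m ℂ) + ((N : ℂ))⁻¹ • A)
        (fun i => (((Real.sqrt N)⁻¹ : ℝ) : ℂ) • M i) with hXdef
    have hXc : ∀ (N : ℕ) (a : Option ι), (X N a)ᴴᵀ =
        Option.elim a ((1 : Matrix m m ℂ) + ((N : ℂ))⁻¹ • Aᴴᵀ)
          (fun i => (((Real.sqrt N)⁻¹ : ℝ) : ℂ) • (M i)ᴴᵀ) :=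
      fun N a => conjTranspose_transpose_approximant A M N a
    -- the continuous functional `Z ↦ Tr[(W ⊗ W̄) Z]`
    set f : Matrix (m × m) (m × m) ℂ → ℂ := fun Z => ((W ⊗ₖ Wᴴᵀ) * Z).trace with hf
    have hfc : Continuous f := (continuous_const.matrix_mul continuous_id).matrix_trace
    -- the limit `N → ∞`
    have hlim : Tendsto (fun N : ℕ => f ((∑ a, X N a ⊗ₖ (X N a)ᴴᵀ) ^ N)) atTop
        (𝓝 (f (NormedSpace.exp (A ⊗ₖ (1 : Matrix m m ℂ) + (1 : Matrix m m ℂ) ⊗ₖ Aᴴᵀ +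
          ∑ i, M i ⊗ₖ (M i)ᴴᵀ)))) := by
      have h := tendsto_approximant_pow A Aᴴᵀ M (fun i => (M i)ᴴᵀ)
      have h2 := (hfc.tendsto _).comp h
      refine h2.congr fun N => ?_
      simp only [Function.comp_apply]
      simp_rw [hXc N, hXdef, sum_option_kronecker_approximant]
    -- the closed target set
    have hclosed : IsClosed {z : ℂ | 0 ≤ z.re ∧ z.im = 0} :=
      (isClosed_le continuous_const Complex.continuous_re).inter
        (isClosed_eq Complex.continuous_im continuous_const)
    have hmem : ∀ N : ℕ, f ((∑ a, X N a ⊗ₖ (X N a)ᴴᵀ) ^ N) ∈ {z : ℂ | 0 ≤ z.re ∧ z.im = 0} :=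
      fun N => trace_twist_mul_pow_kroneckerSum_nonneg W (X N) N
    exact hclosed.mem_of_tendsto hlim (Eventually.of_forall hmem)

end Summit.AtomisticToContinuum.BoseEinsteinCondensation.Theorems.LatticeODLROOffHalfFilling.Ladder

end
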